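import Summits.RiemannHypothesis.RiemannHypothesis.Theorems.SuzukiKernelThetaDeriv

/-!
# A Hölder modulus of continuity for Suzuki's kernel `K_θ` (column DBR; RH-FREE)

RH-FREE throughout; nothing here bears on the truth of RH.

For `θ > 1` the single-operator kernel `K_θ(x) = Re (2π)⁻¹∫_{Im z = 1} Θ_θ(z) e^{−izx} dz`
(`Literature.NumberTheory.LFunctions.limKernel`, [Su20] (1.9)) satisfies a HÖLDER bound, uniform on left
half-lines:

* `exists_abs_limKernel_sub_le_rpow` — there are `C ≥ 0` and `0 < ε ≤ 1` (namely `ε = min 1 ((θ−1)/2)`) with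
  `|K_θ(w + h) − K_θ(w)| ≤ C · e^{w} · |h|^ε` for all real `w` and all `|h| ≤ 1`.

Proof: `K_θ(w+h) − K_θ(w) = Re (2π)⁻¹ ∫ Θ_θ(u+i) e^{−i(u+i)w}(e^{−i(u+i)h} − 1) du`, the symbol decays like
`(1+|u|)^{−θ}` (`norm_limTheta_line_le`), and `‖e^{−i(u+i)h} − 1‖ ≤ 4 (1+|u|)^ε |h|^ε`
(`norm_cexp_sub_one_le_rpow`), leaving the integrable majorant `(1+|u|)^{−(θ−ε)}`.

This is the regularity input for the pairing algebra of `Theorems.SuzukiThetaFlowDefs.FlowPairing`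
(domination of the Gauss–digamma series on the operator side; Hölder continuity of the window outputs
`𝖪_θ[t] f` and of `g ⋆ g̃` on the Weil side).

References: [Su20] M. Suzuki, ASPM 84 (2020) = arXiv:1907.07302, (1.9), Thm 1.2 (K-ii).
-/

noncomputable section

-- D-0017: `Summit.<S>.<S>.…` is the designed namespace of a single-problem summit.
set_option linter.dupNamespace false

open Complex MeasureTheory Filter Topology Set

namespace Summit.RiemannHypothesis.RiemannHypothesis.Theorems.SuzukiKernelSemigroup

open Literature.NumberTheory.LFunctions

/-! ## §1 Elementary bounds for the line phase -/

/-- RH-FREE.  For `Re z ≤ 1` and `0 < ε ≤ 1`: `‖e^z − 1‖ ≤ 4 ‖z‖^ε` (small `z`: `‖e^z − 1‖ ≤ 2‖z‖ ≤ 2‖z‖^ε`;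
large `z`: `‖e^z − 1‖ ≤ e + 1 < 4 ≤ 4‖z‖^ε`). -/
theorem norm_cexp_sub_one_le_rpow {z : ℂ} (hz : z.re ≤ 1) {ε : ℝ} (hε : 0 < ε) (hε1 : ε ≤ 1) :
    ‖Complex.exp z - 1‖ ≤ 4 * ‖z‖ ^ ε := by
  rcases le_or_gt ‖z‖ 1 with h | h
  · have h1 : ‖Complex.exp z - 1‖ ≤ 2 * ‖z‖ := Complex.norm_exp_sub_one_le h
    have h2 : ‖z‖ ≤ ‖z‖ ^ ε := by
      rcases eq_or_lt_of_le (norm_nonneg z) with h0 | h0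
      · rw [← h0, Real.zero_rpow hε.ne']
      · have := Real.rpow_le_rpow_of_exponent_ge h0 h hε1
        rwa [Real.rpow_one] at this
    have h3 : 0 ≤ ‖z‖ ^ ε := Real.rpow_nonneg (norm_nonneg z) ε
    linarith
  · have h1 : ‖Complex.exp z - 1‖ ≤ ‖Complex.exp z‖ + ‖(1 : ℂ)‖ := norm_sub_le _ _
    rw [Complex.norm_exp, norm_one] at h1
    have h2 : Real.exp z.re ≤ Real.exp 1 := Real.exp_le_exp.2 hz
    have h3 : Real.exp 1 < 3 := lt_trans Real.exp_one_lt_d9 (by norm_num)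
    have h4 : 1 ≤ ‖z‖ ^ ε := Real.one_le_rpow h.le hε.le
    linarith

/-- RH-FREE.  `Re(−i(u+i)h) = h`. -/
theorem re_neg_I_line_one_mul (u h : ℝ) : (-I * ((u : ℂ) + ((1 : ℝ) : ℂ) * I) * (h : ℂ)).re = h := by
  simp only [neg_mul, mul_re, neg_re, mul_im, I_re, I_im, add_re, add_im, ofReal_re, ofReal_im,
    mul_zero, mul_one, zero_mul, one_mul, zero_add, add_zero, sub_zero, zero_sub]
  ring

/-- RH-FREE.  `‖−i(u+i)h‖ ≤ |h| (1 + |u|)`. -/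
theorem norm_neg_I_line_one_mul_le (u h : ℝ) :
    ‖-I * ((u : ℂ) + ((1 : ℝ) : ℂ) * I) * (h : ℂ)‖ ≤ |h| * (1 + |u|) := by
  have hline : ‖(u : ℂ) + ((1 : ℝ) : ℂ) * I‖ ≤ 1 + |u| := by
    refine (norm_add_le _ _).trans ?_
    rw [Complex.norm_real, norm_mul, Complex.norm_real, Complex.norm_I, Real.norm_eq_abs,
      Real.norm_eq_abs, abs_one, mul_one]
    linarith
  rw [norm_mul, norm_mul, norm_neg, Complex.norm_I, one_mul, Complex.norm_real, Real.norm_eq_abs,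
    mul_comm]
  exact mul_le_mul_of_nonneg_left hline (abs_nonneg h)

/-- RH-FREE.  The line phase is multiplicative in `x`: `e^{−i(u+i)(w+h)} = e^{−i(u+i)w} e^{−i(u+i)h}`. -/
theorem cexp_line_one_add (u w h : ℝ) :
    Complex.exp (-I * ((u : ℂ) + ((1 : ℝ) : ℂ) * I) * (((w + h : ℝ)) : ℂ)) =
      Complex.exp (-I * ((u : ℂ) + ((1 : ℝ) : ℂ) * I) * (w : ℂ)) *
        Complex.exp (-I * ((u : ℂ) + ((1 : ℝ) : ℂ) * I) * (h : ℂ)) := by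
  rw [← Complex.exp_add]
  congr 1
  push_cast
  ring

/-- RH-FREE.  **Hölder bound for the line phase**: for `0 < ε ≤ 1` and `|h| ≤ 1`,
`‖e^{−i(u+i)(w+h)} − e^{−i(u+i)w}‖ ≤ 4 e^{w} (1+|u|)^ε |h|^ε`. -/
theorem norm_cexp_line_one_sub_le {ε : ℝ} (hε : 0 < ε) (hε1 : ε ≤ 1) (u w : ℝ) {h : ℝ} (hh : |h| ≤ 1) :
    ‖Complex.exp (-I * ((u : ℂ) + ((1 : ℝ) : ℂ) * I) * (((w + h : ℝ)) : ℂ)) -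
        Complex.exp (-I * ((u : ℂ) + ((1 : ℝ) : ℂ) * I) * (w : ℂ))‖ ≤
      4 * Real.exp w * (1 + |u|) ^ ε * |h| ^ ε := by
  rw [cexp_line_one_add, ← mul_sub_one, norm_mul, norm_cexp_line_one]
  have hz := norm_cexp_sub_one_le_rpow (z := -I * ((u : ℂ) + ((1 : ℝ) : ℂ) * I) * (h : ℂ))
    (by rw [re_neg_I_line_one_mul]; exact (le_abs_self h).trans hh) hε hε1
  have hmono : ‖-I * ((u : ℂ) + ((1 : ℝ) : ℂ) * I) * (h : ℂ)‖ ^ ε ≤ (|h| * (1 + |u|)) ^ ε :=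
    Real.rpow_le_rpow (norm_nonneg _) (norm_neg_I_line_one_mul_le u h) hε.le
  rw [Real.mul_rpow (abs_nonneg h) (by positivity)] at hmono
  have hexp : 0 ≤ Real.exp w := (Real.exp_pos w).le
  calc Real.exp w * ‖Complex.exp (-I * ((u : ℂ) + ((1 : ℝ) : ℂ) * I) * (h : ℂ)) - 1‖
      ≤ Real.exp w * (4 * (|h| ^ ε * (1 + |u|) ^ ε)) := by
        refine mul_le_mul_of_nonneg_left (hz.trans ?_) hexp
        linarith
    _ = 4 * Real.exp w * (1 + |u|) ^ ε * |h| ^ ε := by ring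

/-! ## §2 The Hölder modulus of `K_θ` -/

/-- RH-FREE.  The difference of kernel values as ONE line integral:
`K_θ(w+h) − K_θ(w) = (2π)⁻¹ ∫ Θ_θ(u+i)(e^{−i(u+i)(w+h)} − e^{−i(u+i)w}) du` (as complex numbers). -/
theorem ofReal_limKernel_sub_eq {θ : ℝ} (hθ : 1 < θ) (w h : ℝ) :
    (((limKernel θ (w + h) - limKernel θ w : ℝ)) : ℂ) =
      (1 : ℂ) / (2 * (Real.pi : ℂ)) * ∫ u : ℝ, limTheta θ ((u : ℂ) + ((1 : ℝ) : ℂ) * I) *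
        (Complex.exp (-I * ((u : ℂ) + ((1 : ℝ) : ℂ) * I) * (((w + h : ℝ)) : ℂ)) -
          Complex.exp (-I * ((u : ℂ) + ((1 : ℝ) : ℂ) * I) * (w : ℂ))) := by
  have hI1 := integrable_limTheta_lineIntegrand hθ (b := 1) (by norm_num) (w + h)
  have hI0 := integrable_limTheta_lineIntegrand hθ (b := 1) (by norm_num) w
  rw [Complex.ofReal_sub, ofReal_limKernel, ofReal_limKernel]
  unfold invFourierLine
  rw [← mul_sub, ← integral_sub hI1 hI0]
  congr 1
  refine integral_congr_ae (Eventually.of_forall fun u => ?_)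
  simp only
  ring

/-- **RH-FREE · HÖLDER MODULUS OF `K_θ`**: for `θ > 1` there are `C ≥ 0` and `0 < ε ≤ 1` such that
`|K_θ(w + h) − K_θ(w)| ≤ C · e^{w} · |h|^ε` for every real `w` and every `|h| ≤ 1`
(`ε = min 1 ((θ−1)/2)`; `C = (2π)⁻¹ · 4 C₀ ∫(1+|u|)^{−(θ−ε)}du` with `C₀` the symbol-decay constant of
`norm_limTheta_line_le`).  Nothing here bears on RH. -/
theorem exists_abs_limKernel_sub_le_rpow {θ : ℝ} (hθ : 1 < θ) :
    ∃ C ε : ℝ, 0 ≤ C ∧ 0 < ε ∧ ε ≤ 1 ∧ ∀ w h : ℝ, |h| ≤ 1 →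
      |limKernel θ (w + h) - limKernel θ w| ≤ C * Real.exp w * |h| ^ ε := by
  set ε : ℝ := min 1 ((θ - 1) / 2) with hεdef
  have hε0 : 0 < ε := lt_min one_pos (by linarith)
  have hε1 : ε ≤ 1 := min_le_left _ _
  have hθε : 1 < θ - ε := by have := min_le_right 1 ((θ - 1) / 2); linarith
  obtain ⟨C₀, hC₀, hΘ⟩ := norm_limTheta_line_le (θ := θ) (by linarith) (b₀ := 1) (by norm_num)
  set M : ℝ := ∫ u : ℝ, (1 + |u|) ^ (-(θ - ε)) with hM
  have hM0 : 0 ≤ M := integral_nonneg fun u => Real.rpow_nonneg (by positivity) _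
  refine ⟨1 / (2 * Real.pi) * (4 * C₀ * M), ε, by positivity, hε0, hε1, fun w h hh => ?_⟩
  -- pointwise majorant of the integrand
  have hmaj : ∀ u : ℝ, ‖limTheta θ ((u : ℂ) + ((1 : ℝ) : ℂ) * I) *
      (Complex.exp (-I * ((u : ℂ) + ((1 : ℝ) : ℂ) * I) * (((w + h : ℝ)) : ℂ)) -
        Complex.exp (-I * ((u : ℂ) + ((1 : ℝ) : ℂ) * I) * (w : ℂ)))‖ ≤
      (4 * C₀ * Real.exp w * |h| ^ ε) * (1 + |u|) ^ (-(θ - ε)) := by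
    intro u
    have hu0 : 0 < 1 + |u| := by positivity
    rw [norm_mul]
    have h1 := hΘ 1 le_rfl u
    have h2 := norm_cexp_line_one_sub_le hε0 hε1 u w hh
    have hsplit : (1 + |u|) ^ (-θ) * (1 + |u|) ^ ε = (1 + |u|) ^ (-(θ - ε)) := by
      rw [← Real.rpow_add hu0]; congr 1; ring
    calc ‖limTheta θ ((u : ℂ) + ((1 : ℝ) : ℂ) * I)‖ *
          ‖Complex.exp (-I * ((u : ℂ) + ((1 : ℝ) : ℂ) * I) * (((w + h : ℝ)) : ℂ)) -
            Complex.exp (-I * ((u : ℂ) + ((1 : ℝ) : ℂ) * I) * (w : ℂ))‖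
        ≤ (C₀ * (1 + |u|) ^ (-θ)) * (4 * Real.exp w * (1 + |u|) ^ ε * |h| ^ ε) :=
          mul_le_mul h1 h2 (norm_nonneg _) (by positivity)
      _ = (4 * C₀ * Real.exp w * |h| ^ ε) * ((1 + |u|) ^ (-θ) * (1 + |u|) ^ ε) := by ring
      _ = (4 * C₀ * Real.exp w * |h| ^ ε) * (1 + |u|) ^ (-(θ - ε)) := by rw [hsplit]
  have hint : Integrable fun u : ℝ => (4 * C₀ * Real.exp w * |h| ^ ε) * (1 + |u|) ^ (-(θ - ε)) :=
    (integrable_one_add_abs_rpow_neg' hθε).const_mul _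
  have hnorm : ‖∫ u : ℝ, limTheta θ ((u : ℂ) + ((1 : ℝ) : ℂ) * I) *
      (Complex.exp (-I * ((u : ℂ) + ((1 : ℝ) : ℂ) * I) * (((w + h : ℝ)) : ℂ)) -
        Complex.exp (-I * ((u : ℂ) + ((1 : ℝ) : ℂ) * I) * (w : ℂ)))‖ ≤
      (4 * C₀ * Real.exp w * |h| ^ ε) * M := by
    refine (norm_integral_le_of_norm_le hint (Eventually.of_forall hmaj)).trans (le_of_eq ?_)
    rw [integral_const_mul]
  have hpi : ‖(1 : ℂ) / (2 * (Real.pi : ℂ))‖ = 1 / (2 * Real.pi) := by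
    rw [norm_div, norm_mul, norm_one, Complex.norm_real, Complex.norm_two, Real.norm_eq_abs,
      abs_of_pos Real.pi_pos]
  calc |limKernel θ (w + h) - limKernel θ w|
      = ‖(((limKernel θ (w + h) - limKernel θ w : ℝ)) : ℂ)‖ := by
        rw [Complex.norm_real, Real.norm_eq_abs]
    _ = 1 / (2 * Real.pi) * ‖∫ u : ℝ, limTheta θ ((u : ℂ) + ((1 : ℝ) : ℂ) * I) *
        (Complex.exp (-I * ((u : ℂ) + ((1 : ℝ) : ℂ) * I) * (((w + h : ℝ)) : ℂ)) -
          Complex.exp (-I * ((u : ℂ) + ((1 : ℝ) : ℂ) * I) * (w : ℂ)))‖ := by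
        rw [ofReal_limKernel_sub_eq hθ, norm_mul, hpi]
    _ ≤ 1 / (2 * Real.pi) * ((4 * C₀ * Real.exp w * |h| ^ ε) * M) :=
        mul_le_mul_of_nonneg_left hnorm (by positivity)
    _ = 1 / (2 * Real.pi) * (4 * C₀ * M) * Real.exp w * |h| ^ ε := by ring

/-- RH-FREE · the same modulus read on a bounded window: for `θ > 1` and `T` real there are `C ≥ 0`,
`0 < ε ≤ 1` with `|K_θ(x) − K_θ(y)| ≤ C |x − y|^ε` for all `x, y ≤ T` with `|x − y| ≤ 1`
(uniform Hölder continuity of `K_θ` on `(−∞, T]`). -/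
theorem exists_abs_limKernel_sub_le_rpow_of_le {θ : ℝ} (hθ : 1 < θ) (T : ℝ) :
    ∃ C ε : ℝ, 0 ≤ C ∧ 0 < ε ∧ ε ≤ 1 ∧ ∀ x y : ℝ, x ≤ T → y ≤ T → |x - y| ≤ 1 →
      |limKernel θ x - limKernel θ y| ≤ C * |x - y| ^ ε := by
  obtain ⟨C, ε, hC, hε0, hε1, hK⟩ := exists_abs_limKernel_sub_le_rpow hθ
  refine ⟨C * Real.exp T, ε, by positivity, hε0, hε1, fun x y hx hy hxy => ?_⟩
  have h := hK y (x - y) hxy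
  rw [add_sub_cancel] at h
  have hexp : Real.exp y ≤ Real.exp T := Real.exp_le_exp.2 hy
  have hr : 0 ≤ |x - y| ^ ε := Real.rpow_nonneg (abs_nonneg _) ε
  calc |limKernel θ x - limKernel θ y| ≤ C * Real.exp y * |x - y| ^ ε := h
    _ ≤ C * Real.exp T * |x - y| ^ ε := by gcongr

end Summit.RiemannHypothesis.RiemannHypothesis.Theorems.SuzukiKernelSemigroup

end
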